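import Literature.Barriers.BirchSwinnertonDyer.PAdicFunctionalEquationParity

/-!
# BirchSwinnertonDyer / PAdicOrderV2 — crux `PAdicOrderRankOneR4` (stmt-BirchSwinnertonDyer-0515),
# line `Sketch` (tame-shadow-derived-kato), stub P1 `stub_mixedCoeff`

Support file for `stmt-BirchSwinnertonDyer-0515`: the `X¹`-coefficient of the `Λ`-adic duality
identity, pure power-series algebra over a commutative ring `R`. With
`ι = invOnePlusSubOne = (1 + X)⁻¹ - 1 = -X + X² - …` (so `ι(0) = 0`, `ι₁ = -1`), if
`c · t · t(ι) + u · b · w(ι) + ι² · Rs = X² · S` then `u₀ w₀ b₁ = b₀ (u₀ w₁ - u₁ w₀)`: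
* for any series `f`, `f(ι)(0) = f₀` and `(f(ι))₁ = f₁ · ι₁ = -f₁`
  (`coeff_one_subst_of_constantCoeff_eq_zero`);
* the `X¹`-coefficient of `t · t(ι)` is `t₀ · (-t₁) + t₁ · t₀ = 0`;
* those of `ι² · Rs` and `X² · S` vanish (`(ι²)₀ = (ι²)₁ = 0`);
* that of `u · b · w(ι)` is `-u₀ b₀ w₁ + (u₀ b₁ + u₁ b₀) w₀`; summing gives the claim.
-/

set_option linter.dupNamespace false

namespace Summit.BirchSwinnertonDyer.BirchSwinnertonDyer.Theorems.TameShadow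

open PowerSeries Literature.Barriers.BirchSwinnertonDyer

/-- **Linear coefficient under substitution of a series without constant term**:
`(f(g(T)))₁ = f₁ · g₁` when `g(0) = 0` (in `f(g) = ∑ f_d g^d` only `d = 1` contributes to `T¹`:
`(g⁰)₁ = 0` and `ord g^d ≥ d ≥ 2` for `d ≥ 2`). [folklore] -/
theorem coeff_one_subst_of_constantCoeff_eq_zero {R : Type*} [CommRing R] {g : R⟦X⟧}
    (hg : constantCoeff g = 0) (f : R⟦X⟧) :
    coeff 1 (f.subst g) = coeff 1 f * coeff 1 g := by
  rw [coeff_subst' (HasSubst.of_constantCoeff_zero' hg), finsum_eq_single _ 1]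
  · rw [smul_eq_mul, pow_one]
  · intro d hd
    rcases Nat.lt_or_gt_of_ne hd with h | h
    · obtain rfl : d = 0 := by omega
      rw [pow_zero, coeff_one, if_neg one_ne_zero, smul_zero]
    · rw [coeff_of_lt_order 1 (lt_of_lt_of_le (by exact_mod_cast h) (natCast_le_order_pow hg d)),
        smul_zero]

/-- `ι(T)` substituted into `f` keeps the constant term and negates the linear one:
`(f(ι))₀ = f₀`, `(f(ι))₁ = -f₁`. [folklore] -/
theorem coeff_one_subst_invOnePlusSubOne {R : Type*} [CommRing R] (f : R⟦X⟧) :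
    coeff 1 (f.subst invOnePlusSubOne) = -coeff 1 f := by
  rw [coeff_one_subst_of_constantCoeff_eq_zero constantCoeff_invOnePlusSubOne,
    coeff_one_invOnePlusSubOne, mul_neg_one]

/-- **P1 · `stub_mixedCoeff` — the `X¹`-coefficient of the duality identity.** Over any
commutative ring, if `c·t·t(ι) + u·b·w(ι) + ι²·Rs = X²·S` with `ι = invOnePlusSubOne = -X + X² - …`,
then `u₀ w₀ b₁ = b₀ (u₀ w₁ - u₁ w₀)`: the `X¹`-coefficient of `t·t(ι)` vanishes by symmetry
(`t(ι) = t₀ - t₁X + …`), those of `ι²Rs` and `X²S` vanish by order, and that of `u·b·w(ι)` is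
`-u₀b₀w₁ + (u₀b₁ + u₁b₀)w₀`. [folklore] -/
theorem stub_mixedCoeff :
    ∀ {R : Type} [CommRing R] (c : R) (t u b w Rs S : R⟦X⟧),
      C c * t * t.subst invOnePlusSubOne + u * b * w.subst invOnePlusSubOne + invOnePlusSubOne ^ 2 * Rs
          = X ^ 2 * S →
      constantCoeff u * constantCoeff w * coeff 1 b =
        constantCoeff b * (constantCoeff u * coeff 1 w - coeff 1 u * constantCoeff w) := by
  intro R _ c t u b w Rs S h
  have hι0 : constantCoeff (invOnePlusSubOne : R⟦X⟧) = 0 := constantCoeff_invOnePlusSubOne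
  -- take the coefficient of `X¹` on both sides
  have h1 := congrArg (coeff 1) h
  -- right-hand side: `(X² S)₁ = 0`
  have hS : coeff 1 (X ^ 2 * S) = 0 := by
    rw [coeff_X_pow_mul', if_neg (by norm_num)]
  -- `(ι² Rs)₁ = (ι²)₁ Rs₀ + Rs₁ (ι²)₀ = 0`
  have hR : coeff 1 ((invOnePlusSubOne : R⟦X⟧) ^ 2 * Rs) = 0 := by
    rw [coeff_one_mul, coeff_one_pow, map_pow, hι0]
    ring
  -- `(c t t(ι))₁ = c (t₁ t₀ + (-t₁) t₀) = 0`
  have ht : coeff 1 (C c * t * t.subst invOnePlusSubOne) = 0 := by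
    rw [mul_assoc, coeff_C_mul, coeff_one_mul, coeff_one_subst_invOnePlusSubOne,
      constantCoeff_subst_of_constantCoeff_eq_zero hι0]
    ring
  -- `(u b w(ι))₁ = (u b)₁ w₀ + (-w₁) (u b)₀`
  have hubw : coeff 1 (u * b * w.subst invOnePlusSubOne) =
      (coeff 1 u * constantCoeff b + coeff 1 b * constantCoeff u) * constantCoeff w +
        -coeff 1 w * (constantCoeff u * constantCoeff b) := by
    rw [coeff_one_mul, coeff_one_subst_invOnePlusSubOne,
      constantCoeff_subst_of_constantCoeff_eq_zero hι0, coeff_one_mul, map_mul]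
  rw [map_add, map_add, hS, hR, ht, hubw] at h1
  linear_combination h1

end Summit.BirchSwinnertonDyer.BirchSwinnertonDyer.Theorems.TameShadow
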